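import Literature.Computability.AlgebraicComplexity.FSV18SparseTrdegAllFields
import HarnessLib

/-!
# Agrawal–Saha–Saptharishi–Saxena, *Jacobian hits circuits*, §4 Cor. 4.3 ("descent-faithful"):
# lifting a faithful map one level up by a Vandermonde block — proofs only
# (val-lit p2 g3; N1 occur push, plan step F3; lead-np GO 2026-08-26T17:10Z)

Source: M. Agrawal, C. Saha, R. Saptharishi, N. Saxena, *Jacobian hits circuits: hitting-sets,
lower bounds for depth-D occur-k formulas & depth-3 transcendence degree-k circuits*,
arXiv:1111.0582 (STOC 2012 / SICOMP 2016), §4 (held `paper:arxiv-1111.0582`, p0009–p0010) and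
§2 (p0006). Bib key `AgrawalEtAl2011`.

Printed (p0010:L1–L2, L41–L46): "We say that a map is faithful to a collection of sets if it is
faithful to every set in the collection. … **Corollary 4.3.** If `Ψ_{ℓ+1}` is faithful to `𝒞_{ℓ+1}`
then `Ψ_ℓ : x_i ↦ (Σ_{j=1}^{r_ℓ} y_{j,ℓ} · (t_ℓ)^{ij}) + Ψ_{ℓ+1}(x_i)` is faithful to `𝒞_ℓ`, where
`{y_{1,ℓ}, ⋯, y_{r_ℓ,ℓ}, t_ℓ}` is a fresh set of variables." The printed justification is the pair
"Lemma (lem:composition-lemma) & (lem:descent-jacobian)" (p0010:L38): Lemma 4.2 writes a non-zero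
maximal Jacobian minor of `𝒰 ∈ 𝒞_ℓ` as a product `∏ V_i^{e_i}` of polynomials in the sets of
`𝒞_{ℓ+1}`, Thm. 2.1 ("faithful is useful") makes `Ψ_{ℓ+1}` keep each `V_i` — hence the minor —
non-zero, and Lemma 2.2 ("Vandermonde is faithful") is used in the form the authors themselves use
it in §3/§4: "By Lemma (lem:composition-lemma), it suffices to construct a `Ψ` that keeps
`J_{x_r}(T_r) ≠ 0`" (p0009:L36–L38).

## What is here (theorems only; no definitions, no named facts)

Faithfulness to a family `U` is carried, as in `ASSS16.aeval_eq_zero_iff_of_faithful`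
(`ASSS16FaithfulHomomorphisms.lean`, val-lit t18) and in FSV Lemma 52, in its USEFUL form
(Thm. 2.1): `C(U) ≠ 0 ↔ C(Ψ(U)) ≠ 0` for every `C`, i.e. `Ψ` is injective on `𝔽[U]` (which is
equivalent to `trdeg U = trdeg Ψ(U)`).

* `ASSS16.jacobianRank_eq_rank_map_of_minor` — "`Ψ` preserves the rank of the Jacobian" as soon as
  it keeps ONE non-zero minor of maximal size non-zero (one-minor variant of val-lit t21's
  `jacobianRank_eq_rank_map_of_minors`, rank read off the minors over the fraction fields).
* `ASSS16.aeval_recipe_ne_zero_iff_of_minor` — **Lemma 2.2 in minor form**: if `Ψ` keeps a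
  non-zero Jacobian minor of `U` of size `≥ trdeg U` non-zero, the recipe
  `x_k ↦ Σ_{j<r} y_j t^{(k+1)(j+1)} + Ψ(x_k)` is faithful to `U` (= FSV Lemma 52 over every field,
  `ForbesShpilkaVolk2018_lemma52_allFields`, fed with the previous item).
* `ASSS16.exists_trdeg_jacobianMinor_ne_zero` — **§4 ¶2** "Let `𝒰'` be a transcendence basis of
  `𝒰` … [a] nonzero `|𝒰'| × |𝒰'|` minor of `𝒥_x(𝒰')`": over any finite variable type, a family of
  degree `≤ d` and transcendence degree `≤ r` (`char = 0` or `> d^r`) has a non-zero Jacobian minor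
  whose size `ρ` bounds the transcendence degree and whose rows are algebraically independent
  (FSV Fact 51 over every field, `ForbesShpilkaVolk2018_fact51_allFields`, + the rank/minor
  dictionary `Literature.LinearAlgebra.Matrix.exists_det_submatrix_ne_zero_of_le_rank`).
* `ASSS16.descentFaithful` — **Cor. 4.3, the lifting step, in the seed layout of the cell's
  `FSV2018_thm48_topFanIn` / `FSV2018_thm48`** (coefficient variables = multilinear monomials,
  Vandermonde block `vdmGenCoeff` of FSV Prop. 17 / Fact 19 renamed onto a fresh injective block
  `emb : Fin r ⊕ Unit → σ` of the common seed type `σ`, next-level map `Ψ` into the same `σ` not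
  touching that block): if `Ψ` keeps a non-zero Jacobian minor of `U` of size `≥ trdeg U`
  non-zero, then `Ψ_ℓ := [x_m ↦ block(m) + Ψ(x_m)]` is faithful to `U`.
* Cor. 4.3 glue in Thm. 2.1 form (one-liners for the level recursion, plan step F4):
  `ASSS16.map_aeval_ne_zero_of_faithful` (faithful to `W` and `V = Q(W) ≠ 0` ⇒ `Ψ V ≠ 0`),
  `ASSS16.map_prod_pow_ne_zero` (`∏ V_i^{e_i}`), `ASSS16.bind₁_ne_zero_of_faithful` (top level:
  faithful to `T` ⇒ the generator property for `C(T)`).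

Honest framing: typed-and-proved literature in support of the N1 chain (FSV Thm. 48 / [ASSS16]
§4); `VP ≠ VNP` is NOT proved and nothing here is progress on it.

## References
* [AgrawalEtAl2011] arXiv:1111.0582, §2 Thm. 2.1 / Lemma 2.2 (p0006:L40–L60), §4 Lemma 4.2 and
  Cor. 4.3 (p0010:L22–L46), proof of Thm. dDkrPIT (p0009:L26–L38, p0010:L48–L62).
* [ForbesShpilkaVolk2018] FSV, Lemma 52 (seq.) = ToC Lemma 6.3 (the recipe), Fact 51 = ToC
  Fact 6.2, Prop. 17 / Fact 19 (the Vandermonde map `vdmGenCoeff`).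
-/

noncomputable section

namespace Literature.Computability.AlgebraicComplexity

namespace ASSS16

open MvPolynomial Finset Matrix Literature.Barriers.ValiantsHypothesis
open Literature.Algebra.Polynomial.JacobianCriterion

variable {F : Type*} [Field F]

/-! ### Rank preservation from ONE surviving maximal minor -/

/-- **"`Ψ` preserves the rank of the Jacobian" from one minor:** if `rank_{𝔽(X)} Jac_X(F) ≤ ρ` and
some `ρ × ρ` minor of `Jac_X(F)` stays non-zero under `Ψ`, then
`rank_{𝔽(X)} Jac_X(F) = rank_{𝔽(z)} Ψ(Jac_X(F))` (the hypothesis of FSV Lemma 52). One-minor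
variant of `jacobianRank_eq_rank_map_of_minors` (val-lit t21); ranks read off the minors over the
fraction fields (`Literature.LinearAlgebra.Matrix.*`).
[cite: AgrawalEtAl2011, §4 ¶2 ("it suffices to construct a `Ψ` that keeps `J_{x_r}(T_r) ≠ 0`"); ForbesShpilkaVolk2018, Lemma 52 (seq.) = ToC Lemma 6.3]
locator: paper:arxiv-1111.0582 p0009.txt:L36–L38 -/
theorem jacobianRank_eq_rank_map_of_minor {N M₀ M₁ ρ : ℕ} (Fv : Fin M₀ → MvPolynomial (Fin N) F)
    (Φ : MvPolynomial (Fin N) F →ₐ[F] MvPolynomial (Fin M₁) F) (hρ : jacobianRank Fv ≤ ρ)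
    (rows : Fin ρ → Fin M₀) (cols : Fin ρ → Fin N)
    (hΦ : Φ ((jacobianMatrix Fv).submatrix rows cols).det ≠ 0) :
    jacobianRank Fv =
      ((jacobianMatrix Fv).map fun q =>
        algebraMap (MvPolynomial (Fin M₁) F) (FractionRing (MvPolynomial (Fin M₁) F)) (Φ q)).rank := by
  classical
  set J := jacobianMatrix Fv with hJ
  let toX := algebraMap (MvPolynomial (Fin N) F) (FractionRing (MvPolynomial (Fin N) F))
  let φ : MvPolynomial (Fin N) F →+* FractionRing (MvPolynomial (Fin M₁) F) :=
    (algebraMap (MvPolynomial (Fin M₁) F) (FractionRing (MvPolynomial (Fin M₁) F))).comp Φ.toRingHom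
  have hφ : (J.map fun q => algebraMap (MvPolynomial (Fin M₁) F)
      (FractionRing (MvPolynomial (Fin M₁) F)) (Φ q)) = J.map φ := rfl
  have hrank : jacobianRank Fv = (J.map toX).rank := rfl
  rw [hφ]
  -- the surviving minor: `ρ ≤ rank Ψ(J)`
  have hφμ : ((J.map φ).submatrix rows cols).det ≠ 0 := by
    rw [submatrix_map, ← RingHom.mapMatrix_apply, ← RingHom.map_det]
    intro h0
    apply hΦ
    exact IsFractionRing.injective (MvPolynomial (Fin M₁) F) (FractionRing (MvPolynomial (Fin M₁) F))
      (by rw [map_zero]; exact h0)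
  have hge : ρ ≤ (J.map φ).rank := by
    have h := Literature.LinearAlgebra.Matrix.card_le_rank_of_det_submatrix_ne_zero (J.map φ)
      rows cols hφμ
    simpa using h
  -- every `(rank + 1) × (rank + 1)` minor dies already over `𝔽[X]`
  have hle : (J.map φ).rank ≤ jacobianRank Fv := by
    refine Literature.LinearAlgebra.Matrix.rank_le_of_det_submatrix_eq_zero _ fun r' c' => ?_
    have h0 : (J.submatrix r' c').det = 0 := by
      have h := Literature.LinearAlgebra.Matrix.det_submatrix_eq_zero_of_rank_lt_card (J.map toX)
        r' c' (by rw [← hrank, Fintype.card_fin]; exact Nat.lt_succ_self _)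
      rw [submatrix_map, ← RingHom.mapMatrix_apply, ← RingHom.map_det] at h
      exact IsFractionRing.injective (MvPolynomial (Fin N) F) (FractionRing (MvPolynomial (Fin N) F))
        (by rw [map_zero]; exact h)
    rw [submatrix_map, ← RingHom.mapMatrix_apply, ← RingHom.map_det, h0, map_zero]
  omega

/-! ### Lemma 2.2 in minor form (over every field) -/

/-- **[ASSS16] Lemma 2.2 (Vandermonde is faithful), in the minor form used in §3/§4** ("By Lemma
(lem:composition-lemma), it suffices to construct a `Ψ` that keeps `J_{x_r}(T_r) ≠ 0`"): let
`U = (F_1, …, F_m) ⊂ 𝔽[X_1, …, X_N]` have degrees `≤ d`, `trdeg U ≤ r` and `trdeg U ≤ ρ`, and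
`char 𝔽 = 0` or `> d^r`; if `Ψ : 𝔽[X] → 𝔽[z]` keeps some `ρ × ρ` Jacobian minor of `U` non-zero,
then the recipe `X_k ↦ Σ_{j<r} y_j t^{(k+1)(j+1)} + Ψ(X_k)` (FSV Lemma 52's) is faithful to `U` in
the sense of Thm. 2.1: `C(U) ≠ 0 ↔ C(recipe(U)) ≠ 0`. Proof: a surviving `ρ × ρ` minor with
`ρ ≥ trdeg U ≥ rank Jac(U)` (`jacobianRank_le_of_trdegLE`) means `Ψ` preserves the Jacobian rank
(`jacobianRank_eq_rank_map_of_minor`), which is the hypothesis of FSV Lemma 52, a theorem over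
every field (`ForbesShpilkaVolk2018_lemma52_allFields`).
[cite: AgrawalEtAl2011, Lemma 2.2 and §4 ¶2; ForbesShpilkaVolk2018, Lemma 52 (seq.) = ToC Lemma 6.3]
locator: paper:arxiv-1111.0582 p0006.txt:L46–L60, p0009.txt:L36–L38 -/
theorem aeval_recipe_ne_zero_iff_of_minor {N m M d r ρ : ℕ} (U : Fin m → MvPolynomial (Fin N) F)
    (C : MvPolynomial (Fin m) F) (Ψ : MvPolynomial (Fin N) F →ₐ[F] MvPolynomial (Fin M) F)
    (hdeg : ∀ i, (U i).totalDegree ≤ d) (htr : TrdegLE F U r)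
    (hchar : ringChar F = 0 ∨ d ^ r < ringChar F) (hρ : TrdegLE F U ρ)
    (rows : Fin ρ → Fin m) (cols : Fin ρ → Fin N)
    (hΨ : Ψ ((jacobianMatrix U).submatrix rows cols).det ≠ 0) :
    aeval U C ≠ 0 ↔
      aeval (fun i => aeval (fun k : Fin N =>
        (∑ j : Fin r, (X (Sum.inr (Sum.inl j)) : MvPolynomial (Fin M ⊕ (Fin r ⊕ Unit)) F) *
            X (Sum.inr (Sum.inr ())) ^ (((k : ℕ) + 1) * ((j : ℕ) + 1))) +
          rename Sum.inl (Ψ (X k))) (U i)) C ≠ 0 :=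
  ForbesShpilkaVolk2018_lemma52_allFields F N m M d r U C Ψ hdeg htr hchar
    (jacobianRank_eq_rank_map_of_minor U Ψ (jacobianRank_le_of_trdegLE hρ) rows cols hΨ)

/-! ### A non-zero Jacobian minor of transcendence-degree size -/

/-- The `rows × cols` submatrix of a Jacobian matrix, entrywise. [folklore] -/
private theorem jacobianMatrix_submatrix {ι κ κ' γ : Type*} (f : κ → MvPolynomial ι F) (rows : κ' → κ)
    (cols : γ → ι) :
    (jacobianMatrix f).submatrix rows cols = Matrix.of fun u v => pderiv (cols v) (f (rows u)) :=
  Matrix.ext fun _ _ => rfl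

/-- Renaming the variables along an equivalence commutes with taking a Jacobian minor.
[folklore] -/
private theorem det_jacobianMinor_rename {ι ι' : Type*} {m ρ : ℕ} (e : ι ≃ ι') (U : Fin m → MvPolynomial ι F)
    (rows : Fin ρ → Fin m) (cols : Fin ρ → ι) :
    (Matrix.of fun u v => pderiv (e (cols v)) (rename e (U (rows u)))).det =
      rename e (Matrix.of fun u v => pderiv (cols v) (U (rows u))).det := by
  have h : (Matrix.of fun u v => pderiv (e (cols v)) (rename e (U (rows u)))) =
      (Matrix.of fun u v => pderiv (cols v) (U (rows u))).map (rename e) :=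
    Matrix.ext fun u v => by
      simp only [Matrix.of_apply, Matrix.map_apply]
      exact pderiv_rename e.injective (cols v) (U (rows u))
  rw [h, ← AlgHom.coe_toRingHom, ← RingHom.mapMatrix_apply, ← RingHom.map_det]

/-- **[ASSS16] §4 ¶2: "Let `𝒰'` be a transcendence basis of `𝒰` … [take a] nonzero `|𝒰'| × |𝒰'|`
minor of `𝒥_x(𝒰')`."** Over any finite set of variables: a family `U` of degree `≤ d` and
transcendence degree `≤ r`, in characteristic `0` or `> d^r`, has a non-zero `ρ × ρ` Jacobian minor
with `trdeg U ≤ ρ ≤ r`, injective row selection and algebraically independent rows (`ρ` = the size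
of a maximal algebraically independent subfamily = `rank Jac(U)` by FSV Fact 51 over every field,
`ForbesShpilkaVolk2018_fact51_allFields`; the minor by the rank/minor dictionary
`Literature.LinearAlgebra.Matrix.exists_det_submatrix_ne_zero_of_le_rank`; independence of the
rows by `det_jacobianMatrix_submatrix_eq_zero_of_not_algebraicIndependent`).
[cite: AgrawalEtAl2011, §4 ¶2 and proof of Thm. dDkrPIT; ForbesShpilkaVolk2018, Fact 51 (seq.) = ToC Fact 6.2]
locator: paper:arxiv-1111.0582 p0009.txt:L30–L38, p0010.txt:L50–L53 -/
theorem exists_trdeg_jacobianMinor_ne_zero {ι : Type*} [Fintype ι] [DecidableEq ι] {m d r : ℕ}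
    (U : Fin m → MvPolynomial ι F) (hdeg : ∀ i, (U i).totalDegree ≤ d) (htr : TrdegLE F U r)
    (hchar : ringChar F = 0 ∨ d ^ r < ringChar F) :
    ∃ ρ : ℕ, ρ ≤ r ∧ TrdegLE F U ρ ∧
      ∃ (rows : Fin ρ → Fin m) (cols : Fin ρ → ι), Function.Injective rows ∧
        AlgebraicIndependent F (fun u => U (rows u)) ∧
        (Matrix.of fun u v => pderiv (cols v) (U (rows u))).det ≠ 0 := by
  classical
  -- a maximal algebraically independent subfamily `T`; `ρ := |T|`
  obtain ⟨T, hTind, hTmax⟩ : ∃ T : Finset (Fin m), AlgebraicIndependent F (fun i : T => U i) ∧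
      ∀ S : Finset (Fin m), AlgebraicIndependent F (fun i : S => U i) → S.card ≤ T.card := by
    have hne : (Finset.univ.filter fun S : Finset (Fin m) =>
        AlgebraicIndependent F (fun i : S => U i)).Nonempty := by
      refine ⟨∅, Finset.mem_filter.2 ⟨Finset.mem_univ _, ?_⟩⟩
      haveI : IsEmpty (↥(∅ : Finset (Fin m))) := ⟨fun x => Finset.notMem_empty x.1 x.2⟩
      exact algebraicIndependent_empty_type
    obtain ⟨T, hT, hmax⟩ := Finset.exists_max_image _ Finset.card hne
    exact ⟨T, (Finset.mem_filter.1 hT).2,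
      fun S hS => hmax S (Finset.mem_filter.2 ⟨Finset.mem_univ _, hS⟩)⟩
  have hTr : T.card ≤ r := htr T hTind
  refine ⟨T.card, hTr, fun S hS => hTmax S hS, ?_⟩
  -- transport to the variables `Fin N`
  set e : ι ≃ Fin (Fintype.card ι) := Fintype.equivFin ι with he
  set U' : Fin m → MvPolynomial (Fin (Fintype.card ι)) F := fun i => rename e (U i) with hU'
  have hdeg' : ∀ i, (U' i).totalDegree ≤ d := fun i =>
    (totalDegree_rename_le _ _).trans (hdeg i)
  have hto : ∀ S : Finset (Fin m), AlgebraicIndependent F (fun i : S => U' i) →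
      AlgebraicIndependent F (fun i : S => U i) := fun S hS =>
    AlgebraicIndependent.of_comp (rename e : _ →ₐ[F] MvPolynomial (Fin (Fintype.card ι)) F) hS
  have hfrom : ∀ S : Finset (Fin m), AlgebraicIndependent F (fun i : S => U i) →
      AlgebraicIndependent F (fun i : S => U' i) := fun S hS =>
    hS.map (rename_injective _ e.injective).injOn
  have htr' : TrdegLE F U' T.card := fun S hS => hTmax S (hto S hS)
  have hchar' : ringChar F = 0 ∨ d ^ T.card < ringChar F := by
    rcases hchar with h | h
    · exact Or.inl h
    · right
      rcases Nat.eq_zero_or_pos d with rfl | hd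
      · have hp : (ringChar F).Prime :=
          (CharP.char_is_prime_or_zero F (ringChar F)).resolve_right fun h0 => by
            rw [h0] at h
            exact Nat.not_lt_zero _ h
        exact lt_of_le_of_lt ((Nat.pow_le_pow_left (Nat.zero_le 1) T.card).trans_eq (one_pow _))
          hp.one_lt
      · exact lt_of_le_of_lt (Nat.pow_le_pow_right hd hTr) h
  have h51 : jacobianRank U' = T.card :=
    ForbesShpilkaVolk2018_fact51_allFields F _ m d T.card U' hdeg' htr' ⟨T, rfl, hfrom T hTind⟩ hchar'
  -- a non-zero `|T| × |T|` minor of `Jac(U')` over `𝔽(X)`, hence over `𝔽[X]`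
  let toX := algebraMap (MvPolynomial (Fin (Fintype.card ι)) F)
    (FractionRing (MvPolynomial (Fin (Fintype.card ι)) F))
  obtain ⟨rows, cols', hrows, -, hne⟩ :=
    Literature.LinearAlgebra.Matrix.exists_det_submatrix_ne_zero_of_le_rank
      ((jacobianMatrix U').map toX) (s := T.card) (le_of_eq h51.symm)
  have hμ' : ((jacobianMatrix U').submatrix rows cols').det ≠ 0 := by
    intro h0
    apply hne
    rw [submatrix_map, ← RingHom.mapMatrix_apply, ← RingHom.map_det, h0, map_zero]
  -- back to the variables `ι`: columns `e.symm ∘ cols'`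
  have hμ : (Matrix.of fun u v => pderiv (e.symm (cols' v)) (U (rows u))).det ≠ 0 := by
    intro h0
    apply hμ'
    rw [jacobianMatrix_submatrix]
    have h1 : (Matrix.of fun u v => pderiv (cols' v) (U' (rows u))) =
        Matrix.of fun u v => pderiv (e (e.symm (cols' v))) (rename e (U (rows u))) :=
      Matrix.ext fun u v => by simp only [Matrix.of_apply, Equiv.apply_symm_apply, hU']
    rw [h1, det_jacobianMinor_rename e U rows (fun v => e.symm (cols' v)), h0, map_zero]
  refine ⟨rows, fun v => e.symm (cols' v), hrows, ?_, hμ⟩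
  -- the rows are algebraically independent (a dependent square family has vanishing minors)
  by_contra hdep
  apply hμ
  have h := det_jacobianMatrix_submatrix_eq_zero_of_not_algebraicIndependent
    (fun u => U (rows u)) hdep (fun v => e.symm (cols' v))
  rwa [jacobianMatrix_submatrix] at h

/-! ### Cor. 4.3 glue in Thm. 2.1 form -/

/-- **Thm. 2.1 form of faithfulness is what the descent consumes:** if `Ψ` is faithful to the family
`W` (every `Q(W) ≠ 0` stays non-zero) and `V = Q(W) ≠ 0`, then `Ψ(V) ≠ 0` — "`V_i` is a polynomial
in a set of derivatives … `Elem(V_i)` … If `Ψ_{ℓ+1}` is faithful to `𝒞_{ℓ+1}` then …".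
[cite: AgrawalEtAl2011, Thm. 2.1 and Cor. 4.3] locator: paper:arxiv-1111.0582 p0010.txt:L34–L46 -/
theorem map_aeval_ne_zero_of_faithful {ι τ κ : Type*} (Ψ : MvPolynomial ι F →ₐ[F] MvPolynomial τ F)
    (W : κ → MvPolynomial ι F)
    (hW : ∀ Q : MvPolynomial κ F, aeval W Q ≠ 0 → aeval (fun j => Ψ (W j)) Q ≠ 0)
    (Q : MvPolynomial κ F) (hQ : aeval W Q ≠ 0) : Ψ (aeval W Q) ≠ 0 := by
  rw [← AlgHom.comp_apply, comp_aeval]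
  exact hW Q hQ

/-- **A product of powers of preserved factors is preserved** (the shape `∏ V_i^{e_i}` of a
Jacobian minor in Lemma 4.2; `𝔽[z]` is a domain). [cite: AgrawalEtAl2011, Lemma 4.2 and Cor. 4.3]
locator: paper:arxiv-1111.0582 p0010.txt:L22–L33 -/
theorem map_prod_pow_ne_zero {ι τ κ : Type*} (Ψ : MvPolynomial ι F →ₐ[F] MvPolynomial τ F)
    (s : Finset κ) (V : κ → MvPolynomial ι F) (e : κ → ℕ) (h : ∀ i ∈ s, Ψ (V i) ≠ 0) :
    Ψ (∏ i ∈ s, V i ^ e i) ≠ 0 := by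
  rw [map_prod]
  refine Finset.prod_ne_zero_iff.2 fun i hi => ?_
  rw [map_pow]
  exact pow_ne_zero _ (h i hi)

/-- **Top of the recursion (Thm. 2.1 ⇒ hitting): if `bind₁ G` is faithful to `T = (T_1, …, T_t)`
then every non-zero `D = C(T)` stays non-zero under the generator `G`** ("hence, by Theorem
(thm:faithful-pit), it would follow that `Φ(D) = 0` if and only if `D = 0`").
[cite: AgrawalEtAl2011, Thm. 2.1 and §4 ¶2] locator: paper:arxiv-1111.0582 p0007.txt:L19–L21, p0009.txt:L30–L32 -/
theorem bind₁_ne_zero_of_faithful {ι τ κ : Type*} (G : ι → MvPolynomial τ F)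
    (T : κ → MvPolynomial ι F)
    (hT : ∀ Q : MvPolynomial κ F, aeval T Q ≠ 0 → aeval (fun j => bind₁ G (T j)) Q ≠ 0)
    {D : MvPolynomial ι F} (C : MvPolynomial κ F) (hD : D = aeval T C) (hD0 : D ≠ 0) :
    bind₁ G D ≠ 0 := by
  subst hD
  exact map_aeval_ne_zero_of_faithful (bind₁ G) T hT C hD0

/-! ### Cor. 4.3: the lifting step, in the FSV seed layout -/

section Descent

variable {n : ℕ}

/-- **[ASSS16] Cor. 4.3 (descent-faithful), the lifting step, over the seed layout of
`FSV2018_thm48_topFanIn` / `FSV2018_thm48`.** Coefficient variables are the multilinear monomials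
`m` (FSV's `N = 2^n` coordinates, `X_i`, `i = binIndex m`); all levels map into ONE seed type `σ`;
the fresh block "`{y_{1,ℓ}, ⋯, y_{r_ℓ,ℓ}, t_ℓ}`" is an injective `emb : Fin r ⊕ Unit → σ` which the
next-level map `Ψ = Ψ_{ℓ+1}` does not touch, and the block's Vandermonde map is FSV's
`vdmGenCoeff` (Prop. 17 / Fact 19: `X_i ↦ Σ_{j<r} y_j t^{i(j+1)}`) renamed onto it. Statement: if
`U = (F_1, …, F_m)` has degrees `≤ d` and transcendence degree `≤ r` and `≤ ρ`, `char 𝔽 = 0` or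
`> d^r`, and `Ψ` keeps some `ρ × ρ` Jacobian minor of `U` non-zero (in the recursion: the minor
of `exists_trdeg_jacobianMinor_ne_zero`, factored by Lemma 4.2 into polynomials in the sets of
`𝒞_{ℓ+1}`, each kept non-zero by faithfulness one level down — `map_aeval_ne_zero_of_faithful`,
`map_prod_pow_ne_zero`), then `Ψ_ℓ : x_m ↦ block(m) + Ψ(x_m)` is faithful to `U`:
`C(U) ≠ 0 ↔ C(Ψ_ℓ(U)) ≠ 0`. Proof: Lemma 2.2 in minor form (`aeval_recipe_ne_zero_iff_of_minor`,
i.e. FSV Lemma 52 over every field) after (a) factoring `Ψ` through the finitely many seed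
variables it uses, (b) transporting the coefficient variables to `Fin 2^n` along the binary order
(`binaryOrder`, `binIndex_eq_binaryOrder_symm_succ`, as in val-lit t21's Lemma 53 reduction), and
(c) pushing the recipe forward along the injective renaming `Fin M ⊕ (Fin r ⊕ Unit) ↪ σ`.
[cite: AgrawalEtAl2011, Cor. 4.3 with Lemma 2.2; ForbesShpilkaVolk2018, Lemma 52 and Prop. 17 / Fact 19 (seq.) = ToC Lemma 6.3, Prop. 4.2 / Fact 4.4]
locator: paper:arxiv-1111.0582 p0010.txt:L41–L46 -/
theorem descentFaithful {m d r ρ : ℕ} {σ : Type*}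
    (U : Fin m → MvPolynomial (multilinearMonomials n) F)
    (hdeg : ∀ i, (U i).totalDegree ≤ d) (htr : TrdegLE F U r)
    (hchar : ringChar F = 0 ∨ d ^ r < ringChar F)
    (Ψ : MvPolynomial (multilinearMonomials n) F →ₐ[F] MvPolynomial σ F)
    (emb : Fin r ⊕ Unit → σ) (hemb : Function.Injective emb)
    (hfresh : ∀ m : multilinearMonomials n, ∀ v ∈ (Ψ (X m)).vars, v ∉ Set.range emb)
    (hρ : TrdegLE F U ρ) (rows : Fin ρ → Fin m) (cols : Fin ρ → multilinearMonomials n)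
    (hΨ : Ψ (Matrix.of fun u v => pderiv (cols v) (U (rows u))).det ≠ 0)
    (C : MvPolynomial (Fin m) F) :
    aeval U C ≠ 0 ↔
      aeval (fun i => aeval (fun m : multilinearMonomials n =>
        rename emb (vdmGenCoeff F n r (m : Fin n →₀ ℕ)) + Ψ (X m)) (U i)) C ≠ 0 := by
  classical
  haveI : Fintype (multilinearMonomials n) := Fintype.ofEquiv (Fin (2 ^ n)) (binaryOrder n)
  /- (a) `Ψ` uses finitely many seed variables: `Ψ = rename ι₀ ∘ Ψ₀`, `Ψ₀` into `Fin M` variables,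
  `ι₀ : Fin M ↪ σ` with image inside the variables of the `Ψ (X m)` (hence off the block). -/
  set V : Finset σ := Finset.univ.biUnion fun m : multilinearMonomials n => (Ψ (X m)).vars with hV
  have hqex : ∀ m : multilinearMonomials n,
      ∃ q : MvPolynomial V F, rename ((↑) : V → σ) q = Ψ (X m) := by
    intro m
    refine exists_rename_eq_of_vars_subset_range _ _ Subtype.val_injective ?_
    intro v hv
    exact ⟨⟨v, Finset.mem_biUnion.2 ⟨m, Finset.mem_univ _, hv⟩⟩, rfl⟩
  choose q hq using hqex
  set M : ℕ := V.card with hM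
  set eV : V ≃ Fin M := V.equivFin with heV
  obtain ⟨ι₀, hι₀inj, hι₀V, hι₀eV⟩ : ∃ ι₀ : Fin M → σ, Function.Injective ι₀ ∧ (∀ k, ι₀ k ∈ V) ∧
      (ι₀ ∘ eV = ((↑) : V → σ)) :=
    ⟨fun k => ((eV.symm k : V) : σ), fun a b h => eV.symm.injective (Subtype.ext h),
      fun k => (eV.symm k).2, funext fun v => by simp⟩
  have hι₀fresh : ∀ k, ι₀ k ∉ Set.range emb := by
    intro k
    obtain ⟨m, -, hm⟩ := Finset.mem_biUnion.1 (hι₀V k)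
    exact hfresh m _ hm
  let Ψ₀ : MvPolynomial (multilinearMonomials n) F →ₐ[F] MvPolynomial (Fin M) F :=
    aeval fun m => rename eV (q m)
  have hΨfac : Ψ = (rename ι₀).comp Ψ₀ := by
    refine MvPolynomial.algHom_ext fun m => ?_
    rw [AlgHom.comp_apply]
    change Ψ (X m) = rename ι₀ (aeval (fun m => rename eV (q m)) (X m))
    rw [aeval_X, rename_rename, hι₀eV, hq m]
  have hΨ₀ : ∀ p, Ψ p = rename ι₀ (Ψ₀ p) := fun p => by
    rw [hΨfac, AlgHom.comp_apply]
  /- (b) transport the coefficient variables to `Fin 2^n` along the binary order. -/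
  set e : multilinearMonomials n ≃ Fin (2 ^ n) := (binaryOrder n).symm with he
  set U' : Fin m → MvPolynomial (Fin (2 ^ n)) F := fun i => rename e (U i) with hU'
  let Ψ₀' : MvPolynomial (Fin (2 ^ n)) F →ₐ[F] MvPolynomial (Fin M) F := Ψ₀.comp (rename e.symm)
  have hdeg' : ∀ i, (U' i).totalDegree ≤ d := fun i =>
    (totalDegree_rename_le _ _).trans (hdeg i)
  have htr' : TrdegLE F U' r := fun S hS =>
    htr S (AlgebraicIndependent.of_comp (rename e : _ →ₐ[F] MvPolynomial (Fin (2 ^ n)) F) hS)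
  have hρ' : TrdegLE F U' ρ := fun S hS =>
    hρ S (AlgebraicIndependent.of_comp (rename e : _ →ₐ[F] MvPolynomial (Fin (2 ^ n)) F) hS)
  -- the surviving minor, transported
  have hΨ₀μ : Ψ₀ (Matrix.of fun u v => pderiv (cols v) (U (rows u))).det ≠ 0 := by
    intro h0
    apply hΨ
    rw [hΨ₀, h0, map_zero]
  have hΨ' : Ψ₀' ((jacobianMatrix U').submatrix rows (fun v => e (cols v))).det ≠ 0 := by
    rw [jacobianMatrix_submatrix]
    have h1 : (Matrix.of fun u v => pderiv (e (cols v)) (U' (rows u))) =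
        Matrix.of fun u v => pderiv (e (cols v)) (rename e (U (rows u))) :=
      Matrix.ext fun u v => by simp only [Matrix.of_apply, hU']
    rw [h1, det_jacobianMinor_rename e U rows cols]
    change Ψ₀ (rename e.symm (rename e (Matrix.of fun u v => pderiv (cols v) (U (rows u))).det)) ≠ 0
    rwa [rename_rename, e.symm_comp_self, rename_id_apply]
  /- (c) Lemma 2.2 in minor form for `U'`, `Ψ₀'`. -/
  have hB := aeval_recipe_ne_zero_iff_of_minor U' C Ψ₀' hdeg' htr' hchar hρ' rows
    (fun v => e (cols v)) hΨ'
  /- (d) push forward along `g : Fin M ⊕ (Fin r ⊕ Unit) ↪ σ`, `g = ι₀ ⊔ emb`. -/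
  set ψ : Fin (2 ^ n) → MvPolynomial (Fin M ⊕ (Fin r ⊕ Unit)) F := fun k =>
    (∑ j : Fin r, (X (Sum.inr (Sum.inl j)) : MvPolynomial (Fin M ⊕ (Fin r ⊕ Unit)) F) *
        X (Sum.inr (Sum.inr ())) ^ (((k : ℕ) + 1) * ((j : ℕ) + 1))) +
      rename Sum.inl (Ψ₀' (X k)) with hψ
  obtain ⟨g, hginl, hginr⟩ : ∃ g : Fin M ⊕ (Fin r ⊕ Unit) → σ,
      (∀ a, g (Sum.inl a) = ι₀ a) ∧ (∀ b, g (Sum.inr b) = emb b) :=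
    ⟨Sum.elim ι₀ emb, fun _ => rfl, fun _ => rfl⟩
  have hg : Function.Injective g := by
    rintro (a | a) (b | b) h
    · rw [hginl, hginl] at h
      rw [hι₀inj h]
    · rw [hginl, hginr] at h
      exact absurd ⟨b, h.symm⟩ (hι₀fresh a)
    · rw [hginr, hginl] at h
      exact absurd ⟨a, h⟩ (hι₀fresh b)
    · rw [hginr, hginr] at h
      rw [hemb h]
  have hgl : g ∘ Sum.inl = ι₀ := funext hginl
  -- the recipe of Lemma 2.2 pushed along `g` is the block ⊕ `Ψ`
  have key : ∀ mm : multilinearMonomials n,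
      rename g (ψ (e mm)) = rename emb (vdmGenCoeff F n r (mm : Fin n →₀ ℕ)) + Ψ (X mm) := by
    intro mm
    show rename g ((∑ j : Fin r, (X (Sum.inr (Sum.inl j)) : MvPolynomial (Fin M ⊕ (Fin r ⊕ Unit)) F) *
          X (Sum.inr (Sum.inr ())) ^ ((((e mm : Fin (2 ^ n)) : ℕ) + 1) * ((j : ℕ) + 1))) +
        rename Sum.inl (Ψ₀' (X (e mm)))) = _
    rw [map_add]
    congr 1
    · rw [vdmGenCoeff, map_sum, map_sum]
      refine Finset.sum_congr rfl fun j _ => ?_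
      rw [map_mul, map_pow, rename_X, rename_X, map_mul, map_pow, rename_X, rename_X, hginr, hginr,
        binIndex_eq_binaryOrder_symm_succ, ← he, Nat.mul_comm]
    · rw [rename_rename, hgl]
      change rename ι₀ (Ψ₀ (rename e.symm (X (e mm)))) = Ψ (X mm)
      rw [rename_X, Equiv.symm_apply_apply, ← hΨ₀]
  have hR : aeval (fun i => aeval (fun mm : multilinearMonomials n =>
        rename emb (vdmGenCoeff F n r (mm : Fin n →₀ ℕ)) + Ψ (X mm)) (U i)) C =
      rename g (aeval (fun i => aeval ψ (U' i)) C) := by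
    have hf : (fun mm : multilinearMonomials n =>
        rename emb (vdmGenCoeff F n r (mm : Fin n →₀ ℕ)) + Ψ (X mm)) =
        fun mm => rename g (ψ (e mm)) :=
      funext fun mm => (key mm).symm
    have h3 : (fun i => aeval (fun mm : multilinearMonomials n => rename g (ψ (e mm))) (U i)) =
        fun i => rename g (aeval ψ (U' i)) := by
      funext i
      change _ = rename g (aeval ψ (rename e (U i)))
      rw [aeval_rename, ← AlgHom.comp_apply, comp_aeval]
      rfl
    rw [hf, h3, ← comp_aeval, AlgHom.comp_apply]
  have hL : aeval U' C = rename e (aeval U C) := by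
    change aeval (fun i => rename e (U i)) C = _
    rw [← comp_aeval, AlgHom.comp_apply]
  calc aeval U C ≠ 0 ↔ aeval U' C ≠ 0 := by
        rw [hL, map_ne_zero_iff _ (rename_injective _ e.injective)]
    _ ↔ aeval (fun i => aeval ψ (U' i)) C ≠ 0 := hB
    _ ↔ _ := by rw [hR, map_ne_zero_iff _ (rename_injective _ hg)]

end Descent

/-! ### Cor. 4.3 glue, adjoin form (the output shape of `ASSS16.descentJacobian`) -/

/-- **Faithful to `W` ⇒ every non-zero `V ∈ 𝔽[W]` stays non-zero** — the form in which Lemma 4.2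
delivers the next level ("`V_i` is a polynomial in a set of derivatives of gates at the `(ℓ+1)`-th
level — denote this set by `Elem(V_i)`"; val-lit t19's `ASSS16.descentJacobian` outputs
`V ∈ Algebra.adjoin F (Set.range W)`). [cite: AgrawalEtAl2011, Thm. 2.1 and Cor. 4.3]
locator: paper:arxiv-1111.0582 p0010.txt:L34–L46 -/
theorem map_ne_zero_of_faithful_of_mem_adjoin {ι τ κ : Type*}
    (Ψ : MvPolynomial ι F →ₐ[F] MvPolynomial τ F) (W : κ → MvPolynomial ι F)
    (hW : ∀ Q : MvPolynomial κ F, aeval W Q ≠ 0 → aeval (fun j => Ψ (W j)) Q ≠ 0)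
    {V : MvPolynomial ι F} (hV : V ∈ Algebra.adjoin F (Set.range W)) (hV0 : V ≠ 0) : Ψ V ≠ 0 := by
  rw [Algebra.adjoin_range_eq_range_aeval] at hV
  obtain ⟨Q, rfl⟩ := hV
  exact map_aeval_ne_zero_of_faithful Ψ W hW Q hV0

/-- **Faithful to the singleton `{K}` ⇒ `Ψ K ≠ 0`** (the `V_G = G/G'`-type factors of Lemma 4.1 /
the `K`-family of `ASSS16.descentJacobian`: a gate one level down is its own singleton set of
`𝒞_{ℓ+1}`, "the singleton sets `{P_{i,ℓ}}`", p0009:L58–L60).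
[cite: AgrawalEtAl2011, §4 (proof idea) and Cor. 4.3] locator: paper:arxiv-1111.0582 p0009.txt:L55–L62 -/
theorem map_ne_zero_of_faithful_singleton {ι τ : Type*}
    (Ψ : MvPolynomial ι F →ₐ[F] MvPolynomial τ F) (K : MvPolynomial ι F)
    (hW : ∀ Q : MvPolynomial (Fin 1) F, aeval (fun _ : Fin 1 => K) Q ≠ 0 →
      aeval (fun _ : Fin 1 => Ψ K) Q ≠ 0) (hK : K ≠ 0) : Ψ K ≠ 0 := by
  have h := hW (X 0) (by rwa [aeval_X])
  rwa [aeval_X] at h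

/-- **The step of Cor. 4.3 on the output of Lemma 4.2:** if `Ψ` is faithful to the family `W`
and to each singleton `{K_j}`, and the minor `(∏_j K_j^{e_j}) · V` with `V ∈ 𝔽[W]` is non-zero,
then `Ψ` keeps it non-zero (`𝔽[z]` a domain) — ready for `descentFaithful`'s hypothesis `hΨ`.
[cite: AgrawalEtAl2011, Lemma 4.2 and Cor. 4.3] locator: paper:arxiv-1111.0582 p0010.txt:L22–L46 -/
theorem map_prod_pow_mul_ne_zero_of_faithful {ι τ κ κ' : Type*} [Fintype κ']
    (Ψ : MvPolynomial ι F →ₐ[F] MvPolynomial τ F) (W : κ → MvPolynomial ι F)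
    (hW : ∀ Q : MvPolynomial κ F, aeval W Q ≠ 0 → aeval (fun j => Ψ (W j)) Q ≠ 0)
    (K : κ' → MvPolynomial ι F) (e : κ' → ℕ)
    (hK : ∀ j, ∀ Q : MvPolynomial (Fin 1) F, aeval (fun _ : Fin 1 => K j) Q ≠ 0 →
      aeval (fun _ : Fin 1 => Ψ (K j)) Q ≠ 0)
    {V : MvPolynomial ι F} (hV : V ∈ Algebra.adjoin F (Set.range W))
    (hne : (∏ j, K j ^ e j) * V ≠ 0) : Ψ ((∏ j, K j ^ e j) * V) ≠ 0 := by
  have hV0 : V ≠ 0 := right_ne_zero_of_mul hne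
  rw [map_mul, map_prod]
  refine mul_ne_zero (Finset.prod_ne_zero_iff.2 fun j _ => ?_)
    (map_ne_zero_of_faithful_of_mem_adjoin Ψ W hW hV hV0)
  have hKj : K j ^ e j ≠ 0 := fun h0 =>
    left_ne_zero_of_mul hne (Finset.prod_eq_zero (Finset.mem_univ j) h0)
  rw [map_pow]
  by_cases hK0 : K j = 0
  · have hej : e j = 0 := by
      by_contra h
      exact hKj (by rw [hK0, zero_pow h])
    rw [hej, pow_zero]
    exact one_ne_zero
  · exact pow_ne_zero _ (map_ne_zero_of_faithful_singleton Ψ (K j) (hK j) hK0)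

end ASSS16

end Literature.Computability.AlgebraicComplexity

end
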